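import Summits.Ventures.PercRepro.RankDistLubellUpSet
import Summits.Ventures.PercRepro.RankDistTightSizeLevel

/-!
# PercRepro — THE LUBELL BOUND FOR THE SHADOW OF THE BOTTOM SETS AT EVERY LEVEL (p9, gen 20)

A consequence of Lubell monotonicity for the up-set of the bottom sets (`lubellWP_shadow_le_succ`) on the tight layer
`|E| = p + q`, `ρ(E) = p`: every rank-`u` shadow set `A` has `u ≤ |A| ≤ u + q` (`ncard_le_of_mem_shadowLev_tight`),
the binomial coefficients on `[u, u + q]` are at least `min(C(n, u), C(n, u + q)) = min(C(n, u), C(n, p − u))`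
(unimodality, `choose_ge_min_of_mem_Icc`), the bottom sets are rank-`q` shadow sets of size `q`, so
`s_u / min(C(n, u), C(n, p − u)) ≥ W_u(𝓤) ≥ W_q(𝓤) ≥ #𝓑 / C(n, q)`:
**`#𝓑·min(C(n, u), C(n, p − u)) ≤ s_u·C(n, q)` for every `q ≤ u ≤ p`** (`card_Uq_mul_min_choose_le`).
Below `p/2` this is Corollary Q of `RankDistTightSizeLevel`; above `p/2` it is the first unconditional lower bound
on the shadow at every level (weaker than the row C-048, which asks for `C(n, u)` in place of the minimum).
Nothing here moves any window of the crux.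
-/

namespace PercRepro.RankDist

open Set Finset _root_.Matroid PercRepro.ThmH

/-! ## Unimodality of the binomial coefficients on an interval -/

/-- The binomial coefficients increase up to the middle: `C(n, a) ≤ C(n, k)` for `a ≤ k ≤ n / 2`. -/
lemma choose_le_choose_of_le_half {n a k : ℕ} (hak : a ≤ k) (hk : k ≤ n / 2) : n.choose a ≤ n.choose k := by
  induction k, hak using Nat.le_induction with
  | base => exact le_rfl
  | succ m ham ih => exact (ih (by omega)).trans (Nat.choose_le_succ_of_lt_half_left (by omega))

/-- On `[a, b]` the binomial coefficients are at least the smaller endpoint value. -/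
lemma choose_ge_min_of_mem_Icc {n a b k : ℕ} (hak : a ≤ k) (hkb : k ≤ b) (hbn : b ≤ n) :
    min (n.choose a) (n.choose b) ≤ n.choose k := by
  rcases le_or_gt k (n / 2) with hk | hk
  · exact (min_le_left _ _).trans (choose_le_choose_of_le_half hak hk)
  · refine (min_le_right _ _).trans ?_
    rw [← Nat.choose_symm hbn, ← Nat.choose_symm (hkb.trans hbn)]
    exact choose_le_choose_of_le_half (Nat.sub_le_sub_left hkb n) (by omega)

variable {α : Type} [DecidableEq α] (M : Matroid α) [M.Finite]

/-! ## The shadow as the up-set family of finsets -/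

open scoped Classical in
/-- The rank-`u` members of the bottom-set up-set (finsets) coerce onto the rank-`u` shadow (sets). -/
lemma card_rankLevelFinP_containsBottom (p q u : ℕ) :
    (rankLevelFinP M (ContainsBottom M p q) u).card = (shadowLev M u (PerFlat.Uq M p q)).card := by
  refine Finset.card_bij (fun A _ => (A : Set α)) (fun A hA => ?_) (fun A₁ _ A₂ _ h => Finset.coe_injective h)
    (fun A hA => ?_)
  · rw [mem_rankLevelFinP, mem_rankLevelFin] at hA
    obtain ⟨⟨hAE, hAu⟩, B, hB, hBA⟩ := hA
    rw [mem_shadowLev]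
    exact ⟨(subset_gr_iff M).1 hAE, hAu, B, hB, Finset.coe_subset.2 hBA⟩
  · rw [mem_shadowLev] at hA
    obtain ⟨hAE, hAu, B, hB, hBA⟩ := hA
    have hfin : A.Finite := M.ground_finite.subset hAE
    refine ⟨hfin.toFinset, ?_, hfin.coe_toFinset⟩
    rw [mem_rankLevelFinP, mem_rankLevelFin, hfin.coe_toFinset]
    refine ⟨⟨(subset_gr_iff M).2 (by rw [hfin.coe_toFinset]; exact hAE), hAu⟩, B, hB, ?_⟩
    rw [← Finset.coe_subset, hfin.coe_toFinset]
    exact hBA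

open scoped Classical in
/-- Every bottom set of the tight layer is a rank-`q` member of the family, of size `q`. -/
lemma Uq_subset_rankLevelFinP {p q : ℕ} (hn : (gr M).card = p + q) (hr : M.eRank = (p : ℕ∞)) :
    PerFlat.Uq M p q ⊆ rankLevelFinP M (ContainsBottom M p q) q := by
  intro B hB
  obtain ⟨hBE, hBind, hBq, -⟩ := (mem_Uq_tight M hn hr).1 hB
  rw [mem_rankLevelFinP, mem_rankLevelFin]
  refine ⟨⟨hBE, ?_⟩, B, hB, subset_rfl⟩
  have h := hBind.eRk_eq_encard
  rw [eRk_eq_coe_rk M hBind.subset_ground, Set.encard_coe_eq_coe_finsetCard, hBq] at h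
  exact_mod_cast h

/-- Every rank-`u` shadow set of the tight layer has between `u` and `u + q` elements (finset form). -/
lemma card_mem_rankLevelFinP_bounds {p q u : ℕ} (hn : (gr M).card = p + q) (hr : M.eRank = (p : ℕ∞))
    {A : Finset α} (hA : A ∈ rankLevelFinP M (ContainsBottom M p q) u) : u ≤ A.card ∧ A.card ≤ u + q := by
  classical
  rw [mem_rankLevelFinP, mem_rankLevelFin] at hA
  obtain ⟨⟨hAE, hAu⟩, B, hB, hBA⟩ := hA
  have hmem : (A : Set α) ∈ shadowLev M u (PerFlat.Uq M p q) := by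
    rw [mem_shadowLev]
    exact ⟨(subset_gr_iff M).1 hAE, hAu, B, hB, Finset.coe_subset.2 hBA⟩
  have h1 := le_ncard_of_mem_shadowLev M hmem
  have h2 := ncard_le_of_mem_shadowLev_tight M hn hr hmem
  rw [Set.ncard_coe_finset] at h1 h2
  exact ⟨h1, h2⟩

/-- **The Lubell weight of the level-`q` shadow is at least `#𝓑 / C(n, q)`.** -/
lemma card_Uq_div_choose_le_lubellWP {p q : ℕ} (hn : (gr M).card = p + q) (hr : M.eRank = (p : ℕ∞)) :
    ((PerFlat.Uq M p q).card : ℚ) / ((p + q).choose q : ℚ) ≤ lubellWP M (ContainsBottom M p q) q := by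
  classical
  unfold lubellWP
  rw [hn]
  have h : ∑ B ∈ PerFlat.Uq M p q, (1 : ℚ) / ((p + q).choose B.card : ℚ)
      = ((PerFlat.Uq M p q).card : ℚ) / ((p + q).choose q : ℚ) := by
    rw [Finset.sum_congr rfl (fun B hB => by rw [((mem_Uq_tight M hn hr).1 hB).2.2.1]), Finset.sum_const,
      nsmul_eq_mul, mul_one_div]
  rw [← h]
  refine Finset.sum_le_sum_of_subset_of_nonneg (Uq_subset_rankLevelFinP M hn hr) fun A _ _ => ?_
  positivity

/-- **The Lubell weight of the level-`u` shadow is at most `s_u / min(C(n, u), C(n, u + q))`** (tight layer). -/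
lemma lubellWP_mul_min_le {p q u : ℕ} (hn : (gr M).card = p + q) (hr : M.eRank = (p : ℕ∞)) (hup : u + q ≤ p + q) :
    lubellWP M (ContainsBottom M p q) u * (min ((p + q).choose u) ((p + q).choose (u + q)) : ℚ)
      ≤ ((shadowLev M u (PerFlat.Uq M p q)).card : ℚ) := by
  classical
  rw [← card_rankLevelFinP_containsBottom M p q u]
  unfold lubellWP
  rw [hn, Finset.sum_mul, Finset.card_eq_sum_ones, Nat.cast_sum]
  refine Finset.sum_le_sum fun A hA => ?_
  obtain ⟨h1, h2⟩ := card_mem_rankLevelFinP_bounds M hn hr hA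
  have hmin : (min ((p + q).choose u) ((p + q).choose (u + q)) : ℚ) ≤ ((p + q).choose A.card : ℚ) := by
    exact_mod_cast choose_ge_min_of_mem_Icc h1 h2 hup
  have hpos : (0 : ℚ) < ((p + q).choose A.card : ℚ) := by
    exact_mod_cast Nat.choose_pos (h2.trans hup)
  rw [Nat.cast_one, one_div_mul_eq_div, div_le_one hpos]
  exact hmin

/-- **THE LUBELL BOUND FOR THE SHADOW AT EVERY LEVEL** (tight layer, `q ≤ u ≤ p`):
`#𝓑·min(C(n, u), C(n, p − u)) ≤ s_u·C(n, q)`. -/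
theorem card_Uq_mul_min_choose_le {p q u : ℕ} (hn : (gr M).card = p + q) (hr : M.eRank = (p : ℕ∞))
    (hqu : q ≤ u) (hup : u ≤ p) :
    (PerFlat.Uq M p q).card * min ((p + q).choose u) ((p + q).choose (p - u))
      ≤ (shadowLev M u (PerFlat.Uq M p q)).card * (p + q).choose q := by
  classical
  have hmono := lubellWP_mono M (containsBottom_upClosed M p q) hr hqu hup
  have hq := card_Uq_div_choose_le_lubellWP M hn hr
  have hu := lubellWP_mul_min_le M hn hr (u := u) (by omega)
  have hsymm : (p + q).choose (u + q) = (p + q).choose (p - u) := by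
    rw [← Nat.choose_symm (by omega)]
    congr 1
    omega
  rw [hsymm] at hu
  have hposq : (0 : ℚ) < ((p + q).choose q : ℚ) := by exact_mod_cast Nat.choose_pos (by omega)
  have key : ((PerFlat.Uq M p q).card : ℚ) * (min ((p + q).choose u) ((p + q).choose (p - u)) : ℚ)
      ≤ ((shadowLev M u (PerFlat.Uq M p q)).card : ℚ) * ((p + q).choose q : ℚ) := by
    have hminnn : (0 : ℚ) ≤ (min ((p + q).choose u) ((p + q).choose (p - u)) : ℚ) := by positivity
    calc ((PerFlat.Uq M p q).card : ℚ) * (min ((p + q).choose u) ((p + q).choose (p - u)) : ℚ)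
        = (((PerFlat.Uq M p q).card : ℚ) / ((p + q).choose q : ℚ))
            * (min ((p + q).choose u) ((p + q).choose (p - u)) : ℚ) * ((p + q).choose q : ℚ) := by
          field_simp
      _ ≤ lubellWP M (ContainsBottom M p q) u * (min ((p + q).choose u) ((p + q).choose (p - u)) : ℚ)
            * ((p + q).choose q : ℚ) := by
          gcongr
          exact hq.trans hmono
      _ ≤ ((shadowLev M u (PerFlat.Uq M p q)).card : ℚ) * ((p + q).choose q : ℚ) := by
          gcongr
  exact_mod_cast key

end PercRepro.RankDist
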